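import Summits.SmoothPoincare4.SmoothPoincare4.Theses.EntropyRung
import Summits.SmoothPoincare4.SmoothPoincare4.Theorems.EntropyRungSubcylindricalExistenceCutoffFamilyZone
import HarnessLib

/-!
# Integrability of `ρ⁻⁴` on a chart annulus
(crux stmt-SmoothPoincare4-10871 `EntropyRung.SubcylindricalExistence`, line
`fat-conical-core-avr-logsobolev`, aux helper `helper_cutoffFamily_zoneIntegrable` for the stub
`helper_cutoffFamily` (H-cut) of lead c4's skeleton; companion of
`helper_cutoffFamily_zoneIntegral`)

For a smooth Riemannian metric `g` on a smooth `4`-manifold `M` of the summit binder, a point `p`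
with chart `φ = extChartAt (𝓡 4) p`, `y₀ = φ p`, and `closedBall y₀ r ⊆ φ.target`, the function
`x ↦ ‖φ x − y₀‖⁻⁴` is integrable (for `dV_g`) on every chart annulus
`Z = {x ∈ φ.source | a ≤ ‖φ x − y₀‖ ≤ b}` with `0 < a`, `b ≤ r`: `Z` is a measurable subset of
the compact set `φ⁻¹(closedBall y₀ r)`, hence of finite Riemannian volume (Federer 1969,
§3.2.46; `riemannianVolume_lt_top_of_isCompact_holds`), and the integrand is continuous on `Z`
and bounded there by `a⁻⁴` (`IntegrableOn.of_bound`). Everything is proved; no definition, no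
named fact.

References: H. Federer, *Geometric Measure Theory* (1969), §2.10.11 and §3.2.46 [Federer1969].
-/

noncomputable section

-- the registered namespace `Summit.SmoothPoincare4.SmoothPoincare4.Theorems` repeats a component
set_option linter.dupNamespace false

open scoped Manifold ContDiff Topology ENNReal RealInnerProductSpace
open Set Filter MeasureTheory
open Literature.Geometry.Lorentzian Literature.Geometry.Riemannian

namespace Summit.SmoothPoincare4.SmoothPoincare4.Theorems

namespace HelperCutoffFamilyZoneAux

variable {M : Type*} [TopologicalSpace M] [ChartedSpace (EuclideanSpace ℝ (Fin 4)) M]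
  [IsManifold (𝓡 4) ∞ M] [T3Space M] [MeasurableSpace M] [BorelSpace M]
  (g : PseudoRiemannianMetric (𝓡 4) ∞ (EuclideanSpace ℝ (Fin 4)) (TangentSpace (𝓡 4) : M → Type _))
  (hg : g.IsRiemannian) (p : M)

/-- **`ρ⁻⁴` is integrable on a chart annulus** (workhorse, named hypotheses): for
`closedBall y₀ r ⊆ φ.target`, `0 < a` and `b ≤ r`, `x ↦ ‖φ x − y₀‖⁻⁴` is `dV_g`-integrable on
`{x ∈ φ.source | a ≤ ‖φ x − y₀‖ ≤ b}` (finite volume of the compact `φ⁻¹(closedBall y₀ r)`,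
bounded continuous integrand). [cite: Federer1969, §3.2.46] -/
theorem integrableOn_annulus {r a b : ℝ}
    (hB : Metric.closedBall (extChartAt (𝓡 4) p p) r ⊆ (extChartAt (𝓡 4) p).target)
    (ha : 0 < a) (hbr : b ≤ r) :
    IntegrableOn (fun x ↦ (‖extChartAt (𝓡 4) p x - extChartAt (𝓡 4) p p‖ ^ 4)⁻¹)
      {x | x ∈ (extChartAt (𝓡 4) p).source ∧
        a ≤ ‖extChartAt (𝓡 4) p x - extChartAt (𝓡 4) p p‖ ∧
        ‖extChartAt (𝓡 4) p x - extChartAt (𝓡 4) p p‖ ≤ b}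
      (riemannianMeasure (g.toContMDiffRiemannianMetric hg)) := by
  set φ := extChartAt (𝓡 4) p with hφ
  set y₀ := φ p with hy₀
  set A : Set (EuclideanSpace ℝ (Fin 4)) := {y | a ≤ ‖y - y₀‖ ∧ ‖y - y₀‖ ≤ b} with hA
  have hAB : A ⊆ Metric.closedBall y₀ r := fun y hy ↦ mem_closedBall_iff_norm.2 (hy.2.trans hbr)
  have hAc : IsClosed A :=
    (isClosed_le continuous_const (continuous_id.sub continuous_const).norm).inter
      (isClosed_le (continuous_id.sub continuous_const).norm continuous_const)
  have hZ : {x | x ∈ φ.source ∧ a ≤ ‖φ x - y₀‖ ∧ ‖φ x - y₀‖ ≤ b} = φ.source ∩ φ ⁻¹' A := rfl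
  have hZm : MeasurableSet (φ.source ∩ φ ⁻¹' A) :=
    measurableSet_source_inter_preimage_extChartAt (I := 𝓡 4) p hAc.measurableSet
  rw [hZ]
  -- finite volume: the annulus lies in the compact `φ⁻¹(closedBall y₀ r)`
  have hlt : riemannianMeasure (g.toContMDiffRiemannianMetric hg) (φ.source ∩ φ ⁻¹' A) < ⊤ := by
    have himg : IsCompact (φ.symm '' Metric.closedBall y₀ r) :=
      (isCompact_closedBall _ _).image_of_continuousOn ((continuousOn_extChartAt_symm p).mono hB)
    have hsub : φ.source ∩ φ ⁻¹' A ⊆ φ.symm '' Metric.closedBall y₀ r := by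
      rintro x ⟨hx, hxA⟩
      exact ⟨φ x, hAB hxA, φ.left_inv hx⟩
    exact (measure_mono hsub).trans_lt
      (riemannianVolume_lt_top_of_isCompact_holds (g.toContMDiffRiemannianMetric hg) le_rfl himg)
  -- the integrand is continuous on the annulus and bounded by `a⁻⁴`
  have hpos : ∀ x ∈ φ.source ∩ φ ⁻¹' A, 0 < ‖φ x - y₀‖ := fun x hx ↦ ha.trans_le hx.2.1
  have hcont : ContinuousOn (fun x ↦ (‖φ x - y₀‖ ^ 4)⁻¹) (φ.source ∩ φ ⁻¹' A) := by
    refine ContinuousOn.inv₀ ?_ fun x hx ↦ (pow_pos (hpos x hx) 4).ne'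
    exact (((continuousOn_extChartAt p).mono inter_subset_left).sub continuousOn_const).norm.pow 4
  refine IntegrableOn.of_bound hlt (hcont.aestronglyMeasurable hZm) (a ^ 4)⁻¹ ?_
  refine (ae_restrict_iff' hZm).2 (ae_of_all _ fun x hx ↦ ?_)
  rw [Real.norm_eq_abs, abs_of_nonneg (inv_nonneg.2 (pow_nonneg (norm_nonneg _) 4))]
  exact inv_anti₀ (pow_pos ha 4) (pow_le_pow_left₀ ha.le hx.2.1 4)

end HelperCutoffFamilyZoneAux

/-- **Integrability of `ρ⁻⁴` on a chart annulus** (aux helper `helper_cutoffFamily_zoneIntegrable`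
of the stub `helper_cutoffFamily`, line `fat-conical-core-avr-logsobolev`; ∀-form of
`HelperCutoffFamilyZoneAux.integrableOn_annulus`, companion of `helper_cutoffFamily_zoneIntegral`):
for `closedBall (φ p) r ⊆ φ.target` (`φ = extChartAt (𝓡 4) p`; the flatness clause, the instance
`[g.HasLeviCivita]` and the other binder instances are carried only to match the consumers),
`0 < a` and `b ≤ r`, the function `x ↦ ‖φ x − φ p‖⁻⁴` is `dV_g`-integrable on
`{x ∈ φ.source | a ≤ ‖φ x − φ p‖ ≤ b}`. [cite: Federer1969, §3.2.46] -/
theorem helper_cutoffFamily_zoneIntegrable :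
    ∀ (M : Type) [TopologicalSpace M] [T2Space M] [SecondCountableTopology M]
      [ChartedSpace (EuclideanSpace ℝ (Fin 4)) M] [IsManifold (𝓡 4) ∞ M] [CompactSpace M]
      [T3Space M] [MeasurableSpace M] [BorelSpace M]
      (g : PseudoRiemannianMetric (𝓡 4) ∞ (EuclideanSpace ℝ (Fin 4)) (TangentSpace (𝓡 4) : M → Type _))
      [g.HasLeviCivita] (hg : g.IsRiemannian) (p : M) (r : ℝ),
      (Metric.closedBall (extChartAt (𝓡 4) p p) r ⊆ (extChartAt (𝓡 4) p).target ∧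
        ∀ y ∈ Metric.closedBall (extChartAt (𝓡 4) p p) r, ∀ X W : EuclideanSpace ℝ (Fin 4),
          g.val ((extChartAt (𝓡 4) p).symm y)
            (mfderiv 𝓘(ℝ, EuclideanSpace ℝ (Fin 4)) (𝓡 4) (extChartAt (𝓡 4) p).symm y X)
            (mfderiv 𝓘(ℝ, EuclideanSpace ℝ (Fin 4)) (𝓡 4) (extChartAt (𝓡 4) p).symm y W) = ⟪X, W⟫) →
      ∀ a b : ℝ, 0 < a → b ≤ r →
        IntegrableOn (fun x ↦ (‖extChartAt (𝓡 4) p x - extChartAt (𝓡 4) p p‖ ^ 4)⁻¹)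
          {x | x ∈ (extChartAt (𝓡 4) p).source ∧
            a ≤ ‖extChartAt (𝓡 4) p x - extChartAt (𝓡 4) p p‖ ∧
            ‖extChartAt (𝓡 4) p x - extChartAt (𝓡 4) p p‖ ≤ b}
          (riemannianMeasure (g.toContMDiffRiemannianMetric hg)) := by
  intro M _ _ _ _ _ _ _ _ _ g _ hg p r hflat a b ha hbr
  exact HelperCutoffFamilyZoneAux.integrableOn_annulus g hg p hflat.1 ha hbr

end Summit.SmoothPoincare4.SmoothPoincare4.Theorems

end
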